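/-
Copyright (c) 2026 the pub-hodgecm-mathlib formalisation cell (harness21).  Prover seat hodgecm-mathlib-A-p19 (g29): road «S3-ram» (LEAD F0P3a-plan (g13); owner ∕ (α) keeper
F0P3a-p06 (g16); (Cnt2′) chair F0P3a-p07 (g15), RULINGS (13)(2), (16)(d)), organ **«J2-FRAME-hyp»**, FILE 3: the ASSEMBLED frame — centring conjugator WITH the root depth; 2026-09-02.
-/
import Literature.NumberTheory.Rogawski1990.TypeTwoRamifiedFrameLiteralCentred                  -- ★ p849231 ∕ ED. 2 ★ p849259 (this seat): `forall_v_rerootedCentred_sub_one_le_ram` (§4)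
import Literature.NumberTheory.Rogawski1990.DepthZeroKappaTransferTypeTwoRamifiedWSideCentre      -- ★ p849195 (A-p12 (g25)): the W-side centring conjugator `k`
import Literature.NumberTheory.Rogawski1990.DepthZeroKappaTransferTypeTwoRamifiedDepthDictionary  -- ★ p849164 (chair F0P3a-p07 (g15)): the scalar depth `|2û − tr ĝ|` per regime
import HarnessLib

/-!
# THE J2-FRAME OF THE HYPERBOLIC TYPE-(2) LITERAL, ASSEMBLED: a centring conjugator `k ∈ U(σ_w, Φ₂,w)` together with the root depth of `Γ = ι(k⁻¹(s·ĝ_w)k, 1)`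
# (Kottwitz 1986 §3; Rogawski 1990 §4.9; Labesse–Langlands 1979 §2)

Topic `NumberTheory/Rogawski1990`; namespace `Literature.NumberTheory.Rogawski1990`.  THEOREMS ONLY (no definition, no instance, no notation, no named fact, no `sorry`);
kernel lane `--supports stmt-HodgeConjecture-24833`.  Cell `pub/hodgecm-mathlib` (D-0151), crux H413; road «S3-ram» (Literature seeding, count-neutral): organ «J2-FRAME-hyp»
of the (α) BLOCK-LAW skeleton (chair F0P3a-p07 (g15) RULING (16)(d) «the `hd`-ASSEMBLY»; (α) keeper F0P3a-p06 (g16); consumer F0P3a-p08 (g20)'s `stub_Zhyp_{row,par,branch}`).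
From the J0diff binders ALONE (`hblk hu2 hirr hdisc [hn] m hm β hβ` VERBATIM, plus the centring unit `s`, `s·û₀₀ = 1`): ★ A-p12 (g25)'s W-side centre
`exists_unitary_conj_sub_half_trace_le_centre_of_{even,odd}_depth_ramified` gives `k ∈ U(σ_w, Φ₂,w)` with `|(k⁻¹ĝ_wk − ½tr ĝ_w·1)_{ab}|_w ≤ |ϖ|^{D_E}`, `D_E = 2n−1`
(`N = 2n`) ∕ `2n+1` (`N = 2n+1`); the chair's ★ `typeTwo_depthDictionary_{even,odd}_ram` gives the scalar depth `|2û₀₀ − tr ĝ_w|_w = |ϖ^m|` (regime B, `m < N`) ∕ `< |ϖ^N|`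
(A-even) ∕ `≤ |ϖ^N|` (A-odd, C); FILE 2 §4 `forall_v_rerootedCentred_sub_one_le_ram` combines them.  RESULT: **odd `N`: `|(↑B₀ − 1)ᵢⱼ|_w ≤ |ϖ|^m` in every regime; even
`N`: `≤ |ϖ|^d` for every `d ≤ m` with `d + 1 ≤ N`** (B: `d = m`; A-even: `d = N − 1`).  This is the `hd` ∕ `hBm` ∕ `hroot` input of ★ FILE 1 (`UnitaryLatticeTreeFrameLiteralCentring`)
at `B₀ = k⁻¹(s·ĝ_w)k`; the pen does `obtain ⟨k, hk, hd⟩ := …` and nothing else about the frame.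
HONEST LABEL: HC_CM is proved only modulo the 2 remaining named inputs (hLiu418 24832, h413 24833) until rung 0 closes; unconditional local algebra, count-neutral.

## References
* [Kottwitz1986] R. E. Kottwitz, *Base change for unit elements of Hecke algebras*, Compositio Math. 60 (1986), §3.
* [Rogawski1990] J. D. Rogawski, *Automorphic Representations of Unitary Groups in Three Variables*, Ann. of Math. Stud. 123 (1990), §4.9 pp. 54–56, Lemma 4.9.3.
* [LabesseLanglands1979] J.-P. Labesse, R. P. Langlands, *L-indistinguishability for SL(2)*, Canad. J. Math. 31 (1979), §2 Lemma 2.1 p. 8 (fixed balls of elliptic elements).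
-/

set_option autoImplicit false

noncomputable section

open NumberField IsDedekindDomain Matrix Polynomial
open Literature.NumberTheory.Automorphic Literature.NumberTheory.Automorphic.UnitaryGroup Literature.NumberTheory.Automorphic.UnitaryLatticeTree
open Literature.NumberTheory.Automorphic.HermitianLattice Literature.NumberTheory.GaloisRepresentations
open scoped MatrixGroups ValuativeRel

namespace Literature.NumberTheory.Rogawski1990

variable (L : Type) [Field L] [NumberField L] [IsCMField L] {v : HeightOneSpectrum (𝓞 ↥(maximalRealSubfield L))}
  (w : PlacesOver L v) (hw : IsCMField.complexConj L • w.1 = w.1)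

/-- **THE J2-FRAME OF THE HYPERBOLIC LITERAL, ODD DISCRIMINANT DEPTH `N = 2n+1`**: from the J0diff binders alone, there is `k ∈ U(σ_w, Φ₂,w)` such that the
re-rooted centred block `B₀ = k⁻¹(s·ĝ_w)k` satisfies **`|(↑B₀ − 1)ᵢⱼ|_w ≤ |ϖ|^m`** for all `i j` — in every regime (B: `m < N`, centring depth `D = N ≥ m`, scalar depth `= m`;
A-odd ∕ C: `m = N = D`, scalar depth `≤ N`).  ★ A-p12 (g25) `exists_unitary_conj_sub_half_trace_le_centre_of_odd_depth_ramified` ∘ ★ chair F0P3a-p07 (g15)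
`typeTwo_depthDictionary_odd_ram` ∘ §4. [cite: Kottwitz1986, §3] [cite: Rogawski1990, §4.9 p. 55, Lemma 4.9.3] [cite: LabesseLanglands1979, §2 Lemma 2.1] -/
theorem exists_centre_forall_v_rerootedCentred_sub_one_le_of_odd_ram (he : v.asIdeal.ramificationIdx' w.1.asIdeal ≠ 1)
    (h2 : IsUnit (2 : (ValuativeRel.valuation (w.1.adicCompletion L)).integer))
    (ϖ : w.1.adicCompletion L) (hϖ : Valued.v ϖ = WithZero.exp (-1 : ℤ)) (hσϖ : galAdicCompletionMap (L := L) (IsCMField.complexConj L) hw ϖ = -ϖ)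
    (γH : (cmDatum L 2 (Matrix.of fun i j : Fin 2 => if i.val + j.val + 1 = 2 then (1 : L) else 0)).Local v ×
      (cmDatum L 1 (Matrix.of fun i j : Fin 1 => if i.val + j.val + 1 = 1 then (1 : L) else 0)).Local v)
    (hblk : ∀ i j : Fin 2, Valued.v (((((γH.1.val : GL (Fin 2) (UnitaryGroup.LocalRing L v)).val.map (Pi.evalRingHom (fun w' : PlacesOver L v => w'.1.adicCompletion L) w))) - 1) i j) ≤ Valued.v (ϖ ^ 2))
    (hu2 : Valued.v (finGammaTwo L v γH w - 1) ≤ Valued.v (ϖ ^ 2))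
    (hirr : ¬ ∃ x : (w.1.adicCompletion L), ((((γH.1.val : GL (Fin 2) (UnitaryGroup.LocalRing L v)).val.map (Pi.evalRingHom (fun w' : PlacesOver L v => w'.1.adicCompletion L) w))).charpoly).IsRoot x)
    {n : ℕ}
    (hdisc : Valued.v ((((γH.1.val : GL (Fin 2) (UnitaryGroup.LocalRing L v)).val.map (Pi.evalRingHom (fun w' : PlacesOver L v => w'.1.adicCompletion L) w))).trace ^ 2 - 4 * (((γH.1.val : GL (Fin 2) (UnitaryGroup.LocalRing L v)).val.map (Pi.evalRingHom (fun w' : PlacesOver L v => w'.1.adicCompletion L) w))).det) = WithZero.exp (-((2 * (2 * n + 1) : ℕ) : ℤ)))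
    (m : ℕ) (hm : Valued.v (((finCharpolyTwo L v γH).eval (finGammaTwo L v γH)) w) =
      Valued.v ((toPlace v w (HeckeCharacter.uniformizer ↥(maximalRealSubfield L) v : v.adicCompletion ↥(maximalRealSubfield L))) ^ m))
    (β : (v.adicCompletion ↥(maximalRealSubfield L))ˣ)
    (hβ : toPlace v w (β : v.adicCompletion ↥(maximalRealSubfield L)) =
      -(((finCharpolyTwo L v γH).eval (finGammaTwo L v γH)) w *
          (finGammaTwo L v γH w ^ 2 + ((γH.1.val.val : Matrix (Fin 2) (Fin 2) (LocalRing L v)).map (Pi.evalRingHom (fun w' : PlacesOver L v => w'.1.adicCompletion L) w)).det)) /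
        (2 * finGammaTwo L v γH w ^ 2 * ((γH.1.val.val : Matrix (Fin 2) (Fin 2) (LocalRing L v)).map (Pi.evalRingHom (fun w' : PlacesOver L v => w'.1.adicCompletion L) w)).det))
    (s : (w.1.adicCompletion L)ˣ)
    (hs : (s : w.1.adicCompletion L) * (((localNonsplitEquiv (IsCMField.complexConj L) (Matrix.of fun i j : Fin 1 => if i.val + j.val + 1 = 1 then (1 : L) else 0)
        (IsCMField.complexConj_ne_one L) w hw γH.2).val : GL (Fin 1) (w.1.adicCompletion L)) : Matrix (Fin 1) (Fin 1) (w.1.adicCompletion L)) 0 0 = 1) :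
    ∃ k : GL (Fin 2) (w.1.adicCompletion L), k ∈ unitaryGroupOfForm (galAdicCompletionMap (L := L) (IsCMField.complexConj L) hw)
        (placeForm (Matrix.of fun i j : Fin 2 => if i.val + j.val + 1 = 2 then (1 : L) else 0) w.1) ∧
      ∀ i j, Valued.v ((((k⁻¹ * (Matrix.GeneralLinearGroup.scalar (Fin 2) s *
        ((localNonsplitEquiv (IsCMField.complexConj L) (Matrix.of fun i j : Fin 2 => if i.val + j.val + 1 = 2 then (1 : L) else 0)
          (IsCMField.complexConj_ne_one L) w hw γH.1).val : GL (Fin 2) (w.1.adicCompletion L))) * k : GL (Fin 2) (w.1.adicCompletion L)) :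
            Matrix (Fin 2) (Fin 2) (w.1.adicCompletion L)) - 1) i j) ≤ Valued.v ϖ ^ m := by
  have hϖ0 : ϖ ≠ 0 := fun h0 => by rw [h0, map_zero] at hϖ; exact WithZero.coe_ne_zero hϖ.symm
  obtain ⟨k, hk, hcentre, -⟩ := exists_unitary_conj_sub_half_trace_le_centre_of_odd_depth_ramified L v w hw he h2 (Units.mk0 ϖ hϖ0) hϖ hσϖ γH.1
    hirr hblk hdisc
  obtain ⟨hle, hB, hA⟩ := typeTwo_depthDictionary_odd_ram L w hw he h2 ϖ hϖ hσϖ hblk hu2 hirr hdisc m hm β hβ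
  refine ⟨k, hk, ?_⟩
  rcases hle.lt_or_eq with hlt | heq
  · exact forall_v_rerootedCentred_sub_one_le_ram L w hw h2 ϖ hϖ γH s hs k hle le_rfl hcentre (hB hlt).2.2.2.le
  · exact forall_v_rerootedCentred_sub_one_le_ram L w hw h2 ϖ hϖ γH s hs k hle heq.le hcentre (hA heq).2

/-- **THE J2-FRAME OF THE HYPERBOLIC LITERAL, EVEN DISCRIMINANT DEPTH `N = 2n` (`n ≥ 1`)**: there is `k ∈ U(σ_w, Φ₂,w)` such that `B₀ = k⁻¹(s·ĝ_w)k` satisfies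
**`|(↑B₀ − 1)ᵢⱼ|_w ≤ |ϖ|^d` for every `d ≤ m` with `d + 1 ≤ 2n`** — regime B (`m < N`): take `d = m`; regime A-even (`m = N`): take `d = N − 1` (the centre vertex is one
of the `q+1` around the modular centre, depth `N − 1`; the scalar part is deeper, `< |ϖ^N|`).  ★ A-p12 (g25) `…_of_even_depth_ramified` ∘ ★ chair `typeTwo_depthDictionary_even_ram` ∘ §4.
[cite: Kottwitz1986, §3] [cite: Rogawski1990, §4.9 p. 55, Lemma 4.9.3] [cite: LabesseLanglands1979, §2 Lemma 2.1] -/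
theorem exists_centre_forall_v_rerootedCentred_sub_one_le_of_even_ram (he : v.asIdeal.ramificationIdx' w.1.asIdeal ≠ 1)
    (h2 : IsUnit (2 : (ValuativeRel.valuation (w.1.adicCompletion L)).integer))
    (ϖ : w.1.adicCompletion L) (hϖ : Valued.v ϖ = WithZero.exp (-1 : ℤ)) (hσϖ : galAdicCompletionMap (L := L) (IsCMField.complexConj L) hw ϖ = -ϖ)
    (γH : (cmDatum L 2 (Matrix.of fun i j : Fin 2 => if i.val + j.val + 1 = 2 then (1 : L) else 0)).Local v ×
      (cmDatum L 1 (Matrix.of fun i j : Fin 1 => if i.val + j.val + 1 = 1 then (1 : L) else 0)).Local v)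
    (hblk : ∀ i j : Fin 2, Valued.v (((((γH.1.val : GL (Fin 2) (UnitaryGroup.LocalRing L v)).val.map (Pi.evalRingHom (fun w' : PlacesOver L v => w'.1.adicCompletion L) w))) - 1) i j) ≤ Valued.v (ϖ ^ 2))
    (hu2 : Valued.v (finGammaTwo L v γH w - 1) ≤ Valued.v (ϖ ^ 2))
    (hirr : ¬ ∃ x : (w.1.adicCompletion L), ((((γH.1.val : GL (Fin 2) (UnitaryGroup.LocalRing L v)).val.map (Pi.evalRingHom (fun w' : PlacesOver L v => w'.1.adicCompletion L) w))).charpoly).IsRoot x)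
    {n : ℕ}
    (hdisc : Valued.v ((((γH.1.val : GL (Fin 2) (UnitaryGroup.LocalRing L v)).val.map (Pi.evalRingHom (fun w' : PlacesOver L v => w'.1.adicCompletion L) w))).trace ^ 2 - 4 * (((γH.1.val : GL (Fin 2) (UnitaryGroup.LocalRing L v)).val.map (Pi.evalRingHom (fun w' : PlacesOver L v => w'.1.adicCompletion L) w))).det) = WithZero.exp (-((2 * (2 * n) : ℕ) : ℤ)))
    (hn : 1 ≤ n)
    (m : ℕ) (hm : Valued.v (((finCharpolyTwo L v γH).eval (finGammaTwo L v γH)) w) =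
      Valued.v ((toPlace v w (HeckeCharacter.uniformizer ↥(maximalRealSubfield L) v : v.adicCompletion ↥(maximalRealSubfield L))) ^ m))
    (β : (v.adicCompletion ↥(maximalRealSubfield L))ˣ)
    (hβ : toPlace v w (β : v.adicCompletion ↥(maximalRealSubfield L)) =
      -(((finCharpolyTwo L v γH).eval (finGammaTwo L v γH)) w *
          (finGammaTwo L v γH w ^ 2 + ((γH.1.val.val : Matrix (Fin 2) (Fin 2) (LocalRing L v)).map (Pi.evalRingHom (fun w' : PlacesOver L v => w'.1.adicCompletion L) w)).det)) /
        (2 * finGammaTwo L v γH w ^ 2 * ((γH.1.val.val : Matrix (Fin 2) (Fin 2) (LocalRing L v)).map (Pi.evalRingHom (fun w' : PlacesOver L v => w'.1.adicCompletion L) w)).det))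
    (s : (w.1.adicCompletion L)ˣ)
    (hs : (s : w.1.adicCompletion L) * (((localNonsplitEquiv (IsCMField.complexConj L) (Matrix.of fun i j : Fin 1 => if i.val + j.val + 1 = 1 then (1 : L) else 0)
        (IsCMField.complexConj_ne_one L) w hw γH.2).val : GL (Fin 1) (w.1.adicCompletion L)) : Matrix (Fin 1) (Fin 1) (w.1.adicCompletion L)) 0 0 = 1) :
    ∃ k : GL (Fin 2) (w.1.adicCompletion L), k ∈ unitaryGroupOfForm (galAdicCompletionMap (L := L) (IsCMField.complexConj L) hw)
        (placeForm (Matrix.of fun i j : Fin 2 => if i.val + j.val + 1 = 2 then (1 : L) else 0) w.1) ∧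
      ∀ d : ℕ, d ≤ m → d + 1 ≤ 2 * n → ∀ i j, Valued.v ((((k⁻¹ * (Matrix.GeneralLinearGroup.scalar (Fin 2) s *
        ((localNonsplitEquiv (IsCMField.complexConj L) (Matrix.of fun i j : Fin 2 => if i.val + j.val + 1 = 2 then (1 : L) else 0)
          (IsCMField.complexConj_ne_one L) w hw γH.1).val : GL (Fin 2) (w.1.adicCompletion L))) * k : GL (Fin 2) (w.1.adicCompletion L)) :
            Matrix (Fin 2) (Fin 2) (w.1.adicCompletion L)) - 1) i j) ≤ Valued.v ϖ ^ d := by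
  have hϖ0 : ϖ ≠ 0 := fun h0 => by rw [h0, map_zero] at hϖ; exact WithZero.coe_ne_zero hϖ.symm
  obtain ⟨k, hk, hcentre, -⟩ := exists_unitary_conj_sub_half_trace_le_centre_of_even_depth_ramified L v w hw he h2 (Units.mk0 ϖ hϖ0) hϖ hσϖ γH.1
    hirr hblk hn hdisc
  obtain ⟨hle, hB, hA⟩ := typeTwo_depthDictionary_even_ram L w hw he h2 ϖ hϖ hσϖ hblk hu2 hirr hdisc m hm β hβ
  refine ⟨k, hk, fun d hdm hd2 => ?_⟩
  have hdD : d ≤ 2 * n - 1 := by omega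
  rcases hle.lt_or_eq with hlt | heq
  · exact forall_v_rerootedCentred_sub_one_le_ram L w hw h2 ϖ hϖ γH s hs k hdD hdm hcentre (hB hlt).2.2.2.le
  · exact forall_v_rerootedCentred_sub_one_le_ram L w hw h2 ϖ hϖ γH s hs k hdD (by omega) hcentre (hA heq).2.le

end Literature.NumberTheory.Rogawski1990

end
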